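import Mathlib
import HarnessLib
import Literature.Combinatorics.SimpleGraph.RunningIntersection

/-!
# Interval graphs are the graphs whose maximal cliques can be arranged consecutively
(Gilmore–Hoffman; Fulkerson–Gross; Golumbic, Thm. 8.1 (i) ⟺ (iii) and Thm. 8.3)

Topic `Literature/Combinatorics/SimpleGraph`.  Twenty-fourth file of the chordal series.
[Golumbic, *Algorithmic Graph Theory and Perfect Graphs*, Thm. 8.1 (Gilmore and Hoffman 1964)]:
for an undirected graph `G` the following are equivalent — (i) `G` is an interval graph;
(ii) `G` has no chordless `4`-cycle and its complement is a comparability graph; (iii) the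
maximal cliques of `G` can be linearly ordered such that, for every vertex `x`, the maximal
cliques containing `x` occur consecutively.  [Golumbic, Thm. 8.3 (Fulkerson and Gross 1965)] is
the matrix form of (i) ⟺ (iii): `G` is an interval graph iff its clique matrix has the
consecutive 1's property for columns.  This file proves **(i) ⟺ (iii)** for finite graphs.
Golumbic's text routes (i) ⟹ (iii) through (ii) (transitive orientations); the proof given here
is the direct one: order the maximal cliques `K` by the point `p(K) = max_{x ∈ K} a(x)` (the
largest left endpoint), which lies in every interval of `K` (the one-dimensional Helly property),
so that `K ↦ p(K)` is injective on maximal cliques and a vertex whose interval contains `p(K)`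
belongs to `K` by maximality; (iii) ⟹ (i) is Golumbic's argument verbatim — `x ↦ I(x)`, the
(integer) interval of positions of the maximal cliques containing `x`, represents `G` because two
vertices are adjacent iff they lie in a common maximal clique.

Conventions.  An INTERVAL REPRESENTATION of `G` over a linear order `α` is a pair `a b : V → α`
with `u ∼ v ⟺ u ≠ v ∧ [a u, b u] ∩ [a v, b v] ≠ ∅` (closed intervals `Set.Icc`; the interval
graphs of `IntervalGraphChordal` are the case `α = ℝ`); a CONSECUTIVE ARRANGEMENT of the maximal
cliques is an injective `β : Fin n → Set V` whose range is the set of maximal cliques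
(`Maximal G.IsClique`, as in `CliqueTree.isChordal_iff_exists_cliqueTree`) such that
`x ∈ β i`, `x ∈ β k`, `i ≤ j ≤ k` imply `x ∈ β j` — a clique tree that is a path.

## Contents

* `exists_consecutive_maximalCliques_of_intervalRepresentation` — (i) ⟹ (iii) for a
  representation by nonempty intervals over any linear order [Golumbic, Thm. 8.1 (i) ⟹ (iii)].
* `exists_intervalRepresentation_of_consecutive_maximalCliques` — (iii) ⟹ (i), with integer
  endpoints `a v ≤ b v < n` (positions in the arrangement) [Golumbic, Thm. 8.1 (iii) ⟹ (i)].
* `exists_intervalRepresentation_le` — a real interval representation may be assumed to use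
  nonempty intervals (an empty interval represents an isolated vertex; move it far right).
* **`exists_intervalRepresentation_iff_exists_consecutive_maximalCliques`** —
  [Golumbic, Thm. 8.1 (i) ⟺ (iii); Thm. 8.3]: `G` (finite) has a real interval representation iff
  its maximal cliques admit a consecutive arrangement.

## References

* [Golumbic1980] M. C. Golumbic, *Algorithmic Graph Theory and Perfect Graphs*, Academic Press
  (1980); 2nd ed. (2004), §8.2, Thm. 8.1, Cor. 8.2, Thm. 8.3.  Read: galaxy
  `panama:327388177104967`, pp. 141–143 of the extracted text.
* P. C. Gilmore, A. J. Hoffman, *A characterization of comparability graphs and of interval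
  graphs*, Canad. J. Math. 16 (1964) 539–548; D. R. Fulkerson, O. A. Gross, *Incidence matrices
  and interval graphs*, Pacific J. Math. 15 (1965) 835–855 (attribution, as cited by Golumbic).
-/

namespace Literature.Combinatorics.SimpleGraph

open _root_.SimpleGraph

variable {V : Type*} {G : _root_.SimpleGraph V}

/-- Two closed intervals of a linear order meet iff the larger left endpoint is at most the
smaller right endpoint. [folklore] -/
private theorem icc_inter_icc_nonempty_iff {α : Type*} [LinearOrder α] {a₁ b₁ a₂ b₂ : α} :
    (Set.Icc a₁ b₁ ∩ Set.Icc a₂ b₂).Nonempty ↔ max a₁ a₂ ≤ min b₁ b₂ := by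
  rw [Set.Icc_inter_Icc, Set.nonempty_Icc]

/-- In a graph on a nonempty vertex type a maximal clique is nonempty. [folklore] -/
private theorem Maximal.isClique_nonempty [Nonempty V] {K : Set V} (hK : Maximal G.IsClique K) :
    K.Nonempty := by
  by_contra h
  rw [Set.not_nonempty_iff_eq_empty] at h
  subst h
  obtain ⟨v⟩ := ‹Nonempty V›
  have h1 : G.IsClique ({v} : Set V) := Set.pairwise_singleton v _
  have h2 := hK.2 h1 (Set.empty_subset _)
  exact absurd (h2 (Set.mem_singleton v)) (Set.notMem_empty v)

/-- A vertex adjacent to every vertex of a maximal clique other than itself belongs to it.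
[folklore] -/
private theorem Maximal.mem_of_forall_adj {K : Set V} (hK : Maximal G.IsClique K) {z : V}
    (hz : ∀ x ∈ K, x ≠ z → G.Adj x z) : z ∈ K := by
  have hc : G.IsClique (insert z K) := by
    intro x hx y hy hxy
    rcases hx with rfl | hx <;> rcases hy with rfl | hy
    · exact absurd rfl hxy
    · exact (hz y hy (Ne.symm hxy)).symm
    · exact hz x hx hxy
    · exact hK.1 hx hy hxy
  exact hK.2 hc (Set.subset_insert z K) (Set.mem_insert z K)

/-- Every vertex of a finite graph lies in a maximal clique. [folklore] -/
private theorem exists_maximal_isClique_mem [Finite V] (v : V) :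
    ∃ K, Maximal G.IsClique K ∧ v ∈ K := by
  have hc : G.IsClique ({v} : Set V) := Set.pairwise_singleton v _
  obtain ⟨K, hK, hmax⟩ := Finite.exists_le_maximal (p := G.IsClique) hc
  exact ⟨K, hmax, hK (Set.mem_singleton v)⟩

/-- **(i) ⟹ (iii): the maximal cliques of an interval graph can be arranged consecutively.**
If the finite graph `G` is represented by nonempty closed intervals `[a v, b v]` of a linear
order (`u ∼ v ⟺ u ≠ v ∧ [a u, b u] ∩ [a v, b v] ≠ ∅`), then there is an injective enumeration
`β : Fin n → Set V` of the maximal cliques of `G` such that, for every vertex `x`, the cliques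
containing `x` occur consecutively.  Proof: enumerate the maximal cliques `K` by increasing
`p(K) = max_{x ∈ K} a(x)`, a point of `⋂_{x ∈ K} [a x, b x]` determining `K`.
[cite: Golumbic1980, Thm. 8.1 ((i) ⟹ (iii))] -/
theorem exists_consecutive_maximalCliques_of_intervalRepresentation [Finite V]
    {α : Type*} [LinearOrder α] (a b : V → α) (hab : ∀ v, a v ≤ b v)
    (hadj : ∀ u v, G.Adj u v ↔ u ≠ v ∧ (Set.Icc (a u) (b u) ∩ Set.Icc (a v) (b v)).Nonempty) :
    ∃ (n : ℕ) (β : Fin n → Set V), Function.Injective β ∧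
      (∀ K, Maximal G.IsClique K ↔ K ∈ Set.range β) ∧
      ∀ x (i j k : Fin n), i ≤ j → j ≤ k → x ∈ β i → x ∈ β k → x ∈ β j := by
  classical
  haveI := Fintype.ofFinite V
  cases isEmpty_or_nonempty V with
  | inl hV =>
    refine ⟨1, fun _ => ∅, fun i j _ => Subsingleton.elim i j, fun K => ?_, fun x => isEmptyElim x⟩
    have hK : K = ∅ := Set.eq_empty_of_isEmpty K
    subst hK
    simp only [Set.mem_range, exists_const, iff_true]
    exact ⟨Set.pairwise_empty _, fun K' _ _ => (Set.eq_empty_of_isEmpty K').le⟩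
  | inr hV =>
    -- the finite set of maximal cliques
    obtain ⟨M, hM⟩ : ∃ M : Finset (Set V), ∀ K, K ∈ M ↔ Maximal G.IsClique K :=
      ⟨(Set.toFinite {K : Set V | Maximal G.IsClique K}).toFinset, fun K => by simp⟩
    -- the point `p K = max_{x ∈ K} a x` of a (nonempty) clique
    let KF : Set V → Finset V := fun K => Finset.univ.filter fun v => v ∈ K
    have hKF : ∀ K v, v ∈ KF K ↔ v ∈ K := fun K v => by simp [KF]
    let p : Set V → α := fun K =>
      if h : (KF K).Nonempty then (KF K).sup' h a else a (Classical.arbitrary V)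
    have hKFne : ∀ {K : Set V}, Maximal G.IsClique K → (KF K).Nonempty := fun hK => by
      obtain ⟨v, hv⟩ := Maximal.isClique_nonempty hK
      exact ⟨v, (hKF _ v).2 hv⟩
    -- (P1) `a x ≤ p K` and (P2) `p K ≤ b x` for `x ∈ K`
    have hP1 : ∀ {K : Set V}, Maximal G.IsClique K → ∀ x ∈ K, a x ≤ p K := by
      intro K hK x hx
      have hne := hKFne hK
      simp only [p, dif_pos hne]
      exact Finset.le_sup' a ((hKF K x).2 hx)
    have hP2 : ∀ {K : Set V}, Maximal G.IsClique K → ∀ x ∈ K, p K ≤ b x := by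
      intro K hK x hx
      have hne := hKFne hK
      simp only [p, dif_pos hne]
      obtain ⟨y, hy, hyeq⟩ := Finset.exists_mem_eq_sup' hne a
      rw [hyeq]
      have hy' : y ∈ K := (hKF K y).1 hy
      by_cases hxy : x = y
      · subst hxy; exact hab x
      · have h := ((hadj x y).1 (hK.1 hx hy' hxy)).2
        rw [icc_inter_icc_nonempty_iff] at h
        exact le_trans (le_max_right _ _) (le_trans h (min_le_left _ _))
    -- (Pt) a vertex whose interval contains `p K` belongs to `K`
    have hPt : ∀ {K : Set V}, Maximal G.IsClique K → ∀ z, a z ≤ p K → p K ≤ b z → z ∈ K := by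
      intro K hK z h1 h2
      refine Maximal.mem_of_forall_adj hK fun x hx hxz => (hadj x z).2 ⟨hxz, p K, ?_, ?_⟩
      · exact ⟨hP1 hK x hx, hP2 hK x hx⟩
      · exact ⟨h1, h2⟩
    -- `p` is injective on maximal cliques
    have hinj : ∀ {K K' : Set V}, Maximal G.IsClique K → Maximal G.IsClique K' → p K = p K' →
        K = K' := by
      intro K K' hK hK' hKK'
      apply Set.Subset.antisymm
      · intro z hz
        exact hPt hK' z (hKK' ▸ hP1 hK z hz) (hKK' ▸ hP2 hK z hz)
      · intro z hz
        exact hPt hK z (hKK' ▸ hP1 hK' z hz) (hKK' ▸ hP2 hK' z hz)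
    -- enumerate the maximal cliques by increasing `p`
    set n := M.card with hn
    let e : Fin n ≃ {K // K ∈ M} := M.equivFin.symm
    let f : Fin n → α := fun i => p (e i)
    let σ : Equiv.Perm (Fin n) := Tuple.sort f
    have hmono : Monotone (f ∘ σ) := Tuple.monotone_sort f
    let β : Fin n → Set V := fun i => ((e (σ i) : {K // K ∈ M}) : Set V)
    have hβmax : ∀ i, Maximal G.IsClique (β i) := fun i => (hM _).1 (e (σ i)).2
    have hβp : ∀ {i j : Fin n}, i ≤ j → p (β i) ≤ p (β j) := fun {i j} hij => hmono hij
    refine ⟨n, β, ?_, fun K => ⟨fun hK => ?_, ?_⟩, ?_⟩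
    · -- injective
      intro i j hij
      have h1 : e (σ i) = e (σ j) := Subtype.ext hij
      exact σ.injective (e.injective h1)
    · -- every maximal clique is enumerated
      refine ⟨σ.symm (e.symm ⟨K, (hM K).2 hK⟩), ?_⟩
      simp [β]
    · rintro ⟨i, rfl⟩
      exact hβmax i
    · -- consecutive
      intro x i j k hij hjk hxi hxk
      refine hPt (hβmax j) x ?_ ?_
      · exact le_trans (hP1 (hβmax i) x hxi) (hβp hij)
      · exact le_trans (hβp hjk) (hP2 (hβmax k) x hxk)

/-- **(iii) ⟹ (i): a consecutive arrangement of the maximal cliques yields an interval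
representation.**  If `β : Fin n → Set V` enumerates the maximal cliques of the finite graph `G`
so that the cliques containing any vertex occur consecutively, then `v ↦ [a v, b v]`, the first
and last positions of the cliques containing `v` (`a v ≤ b v < n`), represents `G`: two vertices
are adjacent iff they lie in a common maximal clique. [cite: Golumbic1980, Thm. 8.1 ((iii) ⟹ (i))] -/
theorem exists_intervalRepresentation_of_consecutive_maximalCliques [Finite V] {n : ℕ}
    (β : Fin n → Set V) (hmax : ∀ K, Maximal G.IsClique K ↔ K ∈ Set.range β)
    (hcons : ∀ x (i j k : Fin n), i ≤ j → j ≤ k → x ∈ β i → x ∈ β k → x ∈ β j) :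
    ∃ a b : V → ℕ, (∀ v, a v ≤ b v) ∧ (∀ v, b v < n) ∧
      ∀ u v, G.Adj u v ↔ u ≠ v ∧ (Set.Icc (a u) (b u) ∩ Set.Icc (a v) (b v)).Nonempty := by
  classical
  let S : V → Finset (Fin n) := fun v => Finset.univ.filter fun i => v ∈ β i
  have hS : ∀ v i, i ∈ S v ↔ v ∈ β i := fun v i => by simp [S]
  have hSne : ∀ v, (S v).Nonempty := fun v => by
    obtain ⟨K, hK, hv⟩ := exists_maximal_isClique_mem (G := G) v
    obtain ⟨i, rfl⟩ := (hmax K).1 hK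
    exact ⟨i, (hS v i).2 hv⟩
  refine ⟨fun v => ((S v).min' (hSne v) : ℕ), fun v => ((S v).max' (hSne v) : ℕ),
    fun v => Fin.le_iff_val_le_val.1 (Finset.min'_le_max' _ (hSne v)), fun v => Fin.is_lt _,
    fun u v => ⟨fun huv => ⟨huv.ne, ?_⟩, ?_⟩⟩
  · obtain ⟨K, hK, hu, hv⟩ := exists_maximal_isClique_of_adj huv
    obtain ⟨i, rfl⟩ := (hmax K).1 hK
    refine ⟨(i : ℕ), ⟨?_, ?_⟩, ⟨?_, ?_⟩⟩
    · exact Fin.le_iff_val_le_val.1 (Finset.min'_le _ _ ((hS u i).2 hu))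
    · exact Fin.le_iff_val_le_val.1 (Finset.le_max' _ _ ((hS u i).2 hu))
    · exact Fin.le_iff_val_le_val.1 (Finset.min'_le _ _ ((hS v i).2 hv))
    · exact Fin.le_iff_val_le_val.1 (Finset.le_max' _ _ ((hS v i).2 hv))
  · rintro ⟨hne, t, ⟨htu1, htu2⟩, ⟨htv1, htv2⟩⟩
    have htn : t < n := lt_of_le_of_lt htu2 (Fin.is_lt _)
    set j : Fin n := ⟨t, htn⟩ with hj
    have hmem : ∀ w, ((S w).min' (hSne w) : ℕ) ≤ t → t ≤ ((S w).max' (hSne w) : ℕ) → w ∈ β j := by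
      intro w h1 h2
      refine hcons w ((S w).min' (hSne w)) j ((S w).max' (hSne w)) ?_ ?_ ?_ ?_
      · exact Fin.le_iff_val_le_val.2 h1
      · exact Fin.le_iff_val_le_val.2 h2
      · exact (hS w _).1 (Finset.min'_mem _ _)
      · exact (hS w _).1 (Finset.max'_mem _ _)
    have hcl : G.IsClique (β j) := ((hmax (β j)).2 ⟨j, rfl⟩).1
    exact hcl (hmem u htu1 htu2) (hmem v htv1 htv2) hne

/-- **Empty intervals can be avoided.**  A real interval representation of a finite graph can be
replaced by one using nonempty intervals `a v ≤ b v`: an empty interval `[a v, b v]`, `b v < a v`,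
represents an isolated vertex, which is re-represented by a point to the right of every interval
(distinct isolated vertices by distinct points). [cite: Golumbic1980, §1.1 (interval graphs:
intervals are nonempty by definition)] -/
theorem exists_intervalRepresentation_le [Finite V] (a b : V → ℝ)
    (hadj : ∀ u v, G.Adj u v ↔ u ≠ v ∧ (Set.Icc (a u) (b u) ∩ Set.Icc (a v) (b v)).Nonempty) :
    ∃ a' b' : V → ℝ, (∀ v, a' v ≤ b' v) ∧
      ∀ u v, G.Adj u v ↔ u ≠ v ∧ (Set.Icc (a' u) (b' u) ∩ Set.Icc (a' v) (b' v)).Nonempty := by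
  classical
  haveI := Fintype.ofFinite V
  let e : V → ℕ := fun v => (Fintype.equivFin V v : ℕ)
  have he : Function.Injective e := fun u v h =>
    (Fintype.equivFin V).injective (Fin.ext h)
  let M : ℝ := ∑ v, |b v|
  have hM : ∀ v, b v ≤ M := fun v =>
    le_trans (le_abs_self _) (Finset.single_le_sum (fun w _ => abs_nonneg (b w)) (Finset.mem_univ v))
  let q : V → ℝ := fun v => M + 1 + e v
  have hqM : ∀ v, M < q v := fun v => by
    have : (0 : ℝ) ≤ e v := Nat.cast_nonneg _
    simp only [q]; linarith
  have hq : Function.Injective q := fun u v h => he (by exact_mod_cast (add_left_cancel h : (e u : ℝ) = e v))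
  let a' : V → ℝ := fun v => if b v < a v then q v else a v
  let b' : V → ℝ := fun v => if b v < a v then q v else b v
  have hbad : ∀ {u}, b u < a u → ∀ v, ¬ G.Adj u v := fun {u} hu v h => by
    obtain ⟨t, ⟨h1, h2⟩, -⟩ := ((hadj u v).1 h).2
    linarith
  -- for a vertex with an empty interval the new condition fails as well
  have hbad' : ∀ {u}, b u < a u → ∀ v, u ≠ v →
      ¬ (Set.Icc (a' u) (b' u) ∩ Set.Icc (a' v) (b' v)).Nonempty := by
    intro u hu v huv ⟨t, ⟨h1, h2⟩, ⟨h3, h4⟩⟩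
    simp only [a', b', if_pos hu] at h1 h2
    have ht : t = q u := le_antisymm h2 h1
    by_cases hv : b v < a v
    · simp only [a', b', if_pos hv] at h3 h4
      exact huv (hq (by linarith))
    · simp only [b', if_neg hv] at h4
      have := hM v; have := hqM u; linarith
  refine ⟨a', b', fun v => ?_, fun u v => ?_⟩
  · by_cases hv : b v < a v
    · simp [a', b', if_pos hv]
    · simp only [a', b', if_neg hv]; exact not_lt.1 hv
  by_cases hu : b u < a u
  · exact ⟨fun h => absurd h (hbad hu v), fun h => absurd h.2 (hbad' hu v h.1)⟩
  by_cases hv : b v < a v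
  · refine ⟨fun h => absurd h.symm (hbad hv u), fun h => ?_⟩
    rw [Set.inter_comm] at h
    exact absurd h.2 (hbad' hv u (Ne.symm h.1))
  simp only [a', b', if_neg hu, if_neg hv]
  exact hadj u v

/-- **Gilmore–Hoffman / Fulkerson–Gross: a finite graph is an interval graph iff its maximal
cliques can be linearly ordered so that, for every vertex `x`, the maximal cliques containing `x`
occur consecutively** (equivalently: iff its clique matrix has the consecutive 1's property for
columns).  Interval graphs = intersection graphs of closed real intervals, spelled out as
`∃ a b : V → ℝ, …` (the predicate `IsIntervalGraph` of the companion file `IntervalGraphChordal`).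
[cite: Golumbic1980, Thm. 8.1 ((i) ⟺ (iii)); Thm. 8.3] -/
theorem exists_intervalRepresentation_iff_exists_consecutive_maximalCliques [Finite V] :
    (∃ a b : V → ℝ, ∀ u v, G.Adj u v ↔ u ≠ v ∧ (Set.Icc (a u) (b u) ∩ Set.Icc (a v) (b v)).Nonempty)
      ↔ ∃ (n : ℕ) (β : Fin n → Set V), Function.Injective β ∧
        (∀ K, Maximal G.IsClique K ↔ K ∈ Set.range β) ∧
        ∀ x (i j k : Fin n), i ≤ j → j ≤ k → x ∈ β i → x ∈ β k → x ∈ β j := by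
  constructor
  · rintro ⟨a, b, hadj⟩
    obtain ⟨a', b', hab, hadj'⟩ := exists_intervalRepresentation_le a b hadj
    exact exists_consecutive_maximalCliques_of_intervalRepresentation a' b' hab hadj'
  · rintro ⟨n, β, -, hmax, hcons⟩
    obtain ⟨a, b, -, -, hadj⟩ := exists_intervalRepresentation_of_consecutive_maximalCliques β hmax hcons
    refine ⟨fun v => (a v : ℝ), fun v => (b v : ℝ), fun u v => ?_⟩
    rw [hadj u v, icc_inter_icc_nonempty_iff, icc_inter_icc_nonempty_iff, ← Nat.cast_max,
      ← Nat.cast_min, Nat.cast_le]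

end Literature.Combinatorics.SimpleGraph
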